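import Literature.Barriers.Schanuel.AxiomsDoNotForceSchanuelProofs
import HarnessLib

/-!
# The base `SK`: the standard kernel as a finitely generated partial exponential field

Bays–Kirby 2018 (*Pseudo-exponential maps, variants, and quasiminimality*, Algebra & Number
Theory 12 (2018)), Thm 9.1: Zilber's field `𝔹` is the canonical model `𝕄(SK)` over the base
`F_base = SK`, "where this is defined such that `Γ(SK)` is the graph of `exp` restricted to
`ℚτ`, `τ` transcendental and `ker exp = τℤ` (this `F_base` is called `SK` for standard kernel in
[Kirby 2013 FPEF])". In the tree's vocabulary of bases
(`Literature.NumberTheory.Transcendental.IsStdKernelPartialExpField K D θ τ`,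
`PseudoExpVariants.lean`: a finitely generated partial exponential field with standard kernel,
domain `D`, partial exponential `θ`, kernel generator `τ`) the base `SK` is the case `D = ℚτ`.
This file constructs it (`exists_isStdKernelPartialExpField_span_singleton`), inside `ℂ`, in the
same way as the §9.2 bases of `Literature/Barriers/Schanuel/AxiomsDoNotForceSchanuelProofs.lean`
(`exists_isStdKernelPartialExpField`, domain `span_ℚ(1, τ)`): `τ ∈ ℂ` transcendental,
`θ = exp ∘ g` for a `ℚ`-linear `g : ℂ → ℂ` with `g τ = 2πi` (so `θ(qτ) = e^{2πiq}` runs through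
the roots of unity and `θ(qτ) = 1 ↔ q ∈ ℤ`), and `K = ℚ(ℚτ ∪ θ(ℚτ)) = ℚ^{ab}(τ) ⊆ ℂ`.
It is the base over which a countable quasiminimal chart yields Zilber fields of every
uncountable cardinality (`ZilberFieldExistenceChart.lean`).

## References

* M. Bays, J. Kirby, *Pseudo-exponential maps, variants, and quasiminimality*, Algebra & Number
  Theory 12 (2018), Thm 9.1.
* J. Kirby, *Finitely presented exponential fields*, Algebra & Number Theory 7 (2013), §2
  (the partial exponential field `SK`).
-/

noncomputable section

open Set

namespace Literature.NumberTheory.Transcendental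

/-- A `ℚ`-linear map `g : ℂ → ℂ` with prescribed value at a non-zero `τ` (extend `{τ}` to a
`ℚ`-basis). [folklore] -/
theorem exists_linearMap_apply_eq {τ : ℂ} (hτ : τ ≠ 0) (c : ℂ) :
    ∃ g : ℂ →ₗ[ℚ] ℂ, g τ = c := by
  classical
  have hs : LinearIndepOn ℚ id ({τ} : Set ℂ) := LinearIndepOn.singleton (v := id) hτ
  have hτm : τ ∈ hs.extend (Set.subset_univ _) := hs.subset_extend _ (mem_singleton τ)
  refine ⟨(Module.Basis.extend hs).constr ℚ (fun _ => c), ?_⟩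
  have h := Module.Basis.constr_basis (Module.Basis.extend hs) ℚ (fun _ => c) ⟨τ, hτm⟩
  rwa [Module.Basis.extend_apply_self] at h

/-- **The base `SK` exists**: a finitely generated partial exponential field with standard kernel
whose domain is the kernel line, `D = ℚτ` (Bays–Kirby 2018, Thm 9.1: "`F_base = SK`, where this
is defined such that `Γ(SK)` is the graph of `exp` restricted to `ℚτ`, `τ` transcendental and
`ker exp = τℤ`"; Kirby 2013 FPEF §2). Realised inside `ℂ`: `τ` transcendental,
`θ = exp ∘ g` for a `ℚ`-linear `g` with `g τ = 2πi` (so `θ(qτ) = e^{2πi q}`), and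
`K = ℚ(D ∪ θ(D)) = ℚ^{ab}(τ)`. [cite: BaysKirby2018ANT, Thm 9.1] -/
theorem exists_isStdKernelPartialExpField_span_singleton :
    ∃ (K : Type) (_ : Field K) (_ : CharZero K) (θ : K → K) (t : K),
      IsStdKernelPartialExpField K (Submodule.span ℚ {t}) θ t := by
  classical
  obtain ⟨τ, hτ⟩ := Literature.Barriers.Schanuel.exists_transcendental_complex
  have hτ0 : τ ≠ 0 := fun h => hτ (h ▸ isAlgebraic_zero)
  obtain ⟨g, hgτ⟩ := exists_linearMap_apply_eq hτ0 (2 * Real.pi * Complex.I)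
  set Dc : Submodule ℚ ℂ := Submodule.span ℚ ({τ} : Set ℂ) with hDc
  set θc : ℂ → ℂ := fun z => Complex.exp (g z) with hθc
  set K : Subfield ℂ := Subfield.closure ((Dc : Set ℂ) ∪ θc '' Dc) with hK
  have hDK : (Dc : Set ℂ) ⊆ K := fun x hx => Subfield.subset_closure (Or.inl hx)
  have hθK : ∀ x ∈ Dc, θc x ∈ K := fun x hx => Subfield.subset_closure (Or.inr ⟨x, hx, rfl⟩)
  have hτD : τ ∈ Dc := Submodule.subset_span rfl
  let t : K := ⟨τ, hDK hτD⟩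
  let D : Submodule ℚ K := Submodule.span ℚ ({t} : Set K)
  let θ : K → K := fun x => if hx : (x : ℂ) ∈ Dc then ⟨θc x, hθK x hx⟩ else 1
  have hcoe_smul : ∀ (a : ℚ) (x : K), ((a • x : K) : ℂ) = a • (x : ℂ) := by
    intro a x
    rw [Rat.smul_def, Rat.smul_def, Subfield.coe_mul, SubfieldClass.coe_ratCast]
  have hcoe_zsmul : ∀ (k : ℤ) (x : K), ((k • x : K) : ℂ) = k • (x : ℂ) :=
    fun k x => map_zsmul K.subtype k x
  have hmemD : ∀ x : K, x ∈ D ↔ (x : ℂ) ∈ Dc := by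
    intro x
    rw [Submodule.mem_span_singleton, Submodule.mem_span_singleton]
    constructor
    · rintro ⟨a, rfl⟩
      exact ⟨a, by rw [hcoe_smul]⟩
    · rintro ⟨a, ha⟩
      exact ⟨a, Subtype.ext (by rw [hcoe_smul]; exact ha)⟩
  have hθ_of_mem : ∀ {x : K} (hx : (x : ℂ) ∈ Dc), θ x = ⟨θc x, hθK x hx⟩ := fun hx => dif_pos hx
  -- the kernel: `θ(aτ) = e^{2πi a} = 1 ↔ a ∈ ℤ`
  have hker : ∀ a : ℚ, Complex.exp (g (a • τ)) = 1 ↔ ∃ k : ℤ, (k : ℚ) = a := by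
    intro a
    rw [map_smul, hgτ, Complex.exp_eq_one_iff]
    constructor
    · rintro ⟨n, hn⟩
      refine ⟨n, ?_⟩
      rw [Rat.smul_def] at hn
      have : (a : ℂ) = n := mul_right_cancel₀ Complex.two_pi_I_ne_zero hn
      exact_mod_cast this.symm
    · rintro ⟨k, rfl⟩
      exact ⟨k, by rw [Rat.smul_def]; push_cast; ring⟩
  refine ⟨K, inferInstance, inferInstance, θ, t,
    { finiteDimensional := Module.Finite.span_of_finite ℚ (Set.toFinite _)
      map_add := ?_
      map_ne_zero := ?_
      mem := Submodule.subset_span rfl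
      transcendental := ?_
      map_eq_one_iff := ?_
      closure_eq_top := ?_ }⟩
  · intro x y hx hy
    rw [hmemD] at hx hy
    have hxy : ((x + y : K) : ℂ) ∈ Dc := by rw [Subfield.coe_add]; exact Dc.add_mem hx hy
    rw [hθ_of_mem hxy, hθ_of_mem hx, hθ_of_mem hy]
    refine Subtype.ext ?_
    simp only [hθc, Subfield.coe_add, map_add, Complex.exp_add, Subfield.coe_mul]
  · intro x hx
    rw [hmemD] at hx
    rw [hθ_of_mem hx, Ne, Subtype.ext_iff]
    exact Complex.exp_ne_zero _
  · intro halg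
    exact hτ (halg.algHom K.subtype.toRatAlgHom)
  · intro x hx
    have hx' := (hmemD x).1 hx
    rw [hθ_of_mem hx', Subtype.ext_iff, Subfield.coe_one]
    change Complex.exp (g x) = 1 ↔ _
    obtain ⟨a, ha⟩ := Submodule.mem_span_singleton.1 hx
    have hxa : (x : ℂ) = a • τ := by rw [← ha, hcoe_smul]
    rw [hxa, hker a, AddSubgroup.mem_zmultiples_iff]
    constructor
    · rintro ⟨k, hk⟩
      refine ⟨k, ?_⟩
      rw [← ha, ← hk, Int.cast_smul_eq_zsmul]
    · rintro ⟨k, hk⟩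
      refine ⟨k, ?_⟩
      have h1 : ((k : ℚ) • t : K) = a • t := by rw [Int.cast_smul_eq_zsmul, hk, ha]
      have h2 : ((k : ℚ) • τ : ℂ) = a • τ := by
        have := congrArg (fun w : K => (w : ℂ)) h1
        simpa only [hcoe_smul] using this
      have h3 : ((k : ℚ) : ℂ) * τ = (a : ℂ) * τ := by rwa [Rat.smul_def, Rat.smul_def] at h2
      exact_mod_cast mul_right_cancel₀ hτ0 h3
  · -- `K` is generated by `D ∪ θ(D)`
    rw [eq_top_iff]
    intro x _
    set S : Subfield K := Subfield.closure ((D : Set K) ∪ θ '' D) with hS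
    have hle : K ≤ S.map K.subtype := by
      refine Subfield.closure_le.mpr ?_
      rintro c (hc | ⟨d, hd, rfl⟩)
      · refine ⟨⟨c, hDK hc⟩, Subfield.subset_closure (Or.inl ?_), rfl⟩
        exact (hmemD _).mpr hc
      · refine ⟨θ ⟨d, hDK hd⟩, Subfield.subset_closure (Or.inr ⟨⟨d, hDK hd⟩, ?_, rfl⟩), ?_⟩
        · exact (hmemD _).mpr hd
        · change ((θ ⟨d, hDK hd⟩ : K) : ℂ) = θc d
          rw [hθ_of_mem (x := ⟨d, hDK hd⟩) hd]
    obtain ⟨y, hy, hyx⟩ := hle x.2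
    rwa [← Subtype.val_injective hyx]

end Literature.NumberTheory.Transcendental

end
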